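import Summits.NavierStokesRegularity.NavierStokesRegularity.Theorems.LerayQuarterDissipationFiniteDissipationLiouvilleFinalDatumVorticity
import Literature.Analysis.FluidPDE.LocalEnergyLimitBounds
import HarnessLib

/-!
# Crux `FiniteDissipationLiouville` (stmt-NavierStokesRegularity-22144): the final datum of the
# CRITICAL ELEMENT is weakly divergence-free across the apex and its vorticity is an `L¹_loc`
# function attained in `L¹(ℝ³)` — packaged portrait clause

Theorems file of route `LerayQuarterDissipation` (lead prover ns-lqd-lead g9; `--supports` the
crux, line `birth`; companion of `…FinalDatumVorticity`). Navier–Stokes regularity is NOT proved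
by anything here; no summit is.

* `isWeaklyDivFree_finalDatum` — if the trace of a Type-I ancient mild field is the function `u₀`
  for every test field (`…EnergyTraceDatum.tendsto_pairing_of_energy`), then `u₀` is WEAKLY
  DIVERGENCE-FREE on `ℝ³`, across the apex (the slices are; pass to the limit).
* `finalDatum_vorticity_of_minimal` — for the CRITICAL ELEMENT (`K_c` minimal, `w ∈ 𝒟_{C,K_c}`
  singular): the `C¹` final datum `u₀` with gradient `Du₀` (`…FinalDatumProfile`, lead g7) is the
  trace for every test field, is weakly divergence-free on `ℝ³`, `∇w(t) → Du₀` and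
  `curl w(t) → ω₀ = curlCLM ∘ Du₀` in `L¹(ℝ³)` at the rate `√(−t)`, `ω₀ ∈ L¹_loc` with
  `∫_{B(0,ρ)}‖ω₀‖ ≤ 12|B₁| L ρ`, and the distributional vorticity of the trace IS `ω₀` across the
  apex: **no vorticity concentration at the singular point** (skeleton v18 clause).

Portrait facts; constants from the scale-invariant package of the critical element
(`…EnvelopePackage`, seat ns-lqd-p2 g7); no scenario removed; no summit proved.
-/

noncomputable section

-- the summit and its single sub-problem share the name (CONVENTIONS §1), as in every Theorems file
set_option linter.dupNamespace false

namespace Summit.NavierStokesRegularity.NavierStokesRegularity.Theorems.FiniteDissipationLiouville.FinalDatumVorticity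

open MeasureTheory Set Filter Topology Metric Function TopologicalSpace
open Literature.Analysis Literature.Analysis.FluidPDE
open Summit.NavierStokesRegularity.NavierStokesRegularity.Theorems.FiniteDissipationLiouville
open Summit.NavierStokesRegularity.NavierStokesRegularity.Theorems
open scoped ENNReal NNReal RealInnerProductSpace

variable {C : ℝ} {W : ℝ → EuclideanSpace ℝ (Fin 3) → EuclideanSpace ℝ (Fin 3)}

/-! ### The final datum is weakly divergence-free across the apex -/

/-- **The final datum is WEAKLY DIVERGENCE-FREE on `ℝ³`, across the apex**: if the trace of the
Type-I ancient mild field `W` is the function `u₀` for every test field (`…EnergyTraceDatum`),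
then `∫⟪u₀, ∇θ⟫ = 0` for every scalar test function `θ` (the slices are weakly divergence-free and
the pairings pass to the limit). -/
theorem isWeaklyDivFree_finalDatum (hW : IsTypeIAncientMild C W)
    {u₀ : EuclideanSpace ℝ (Fin 3) → EuclideanSpace ℝ (Fin 3)}
    (htrace : ∀ ψ : EuclideanSpace ℝ (Fin 3) → EuclideanSpace ℝ (Fin 3),
      FunctionSpaces.IsTestFunctionOn (⊤ : Opens (EuclideanSpace ℝ (Fin 3))) ψ →
      Tendsto (fun t => ∫ x, ⟪W t x, ψ x⟫) (𝓝[<] 0) (𝓝 (∫ x, ⟪u₀ x, ψ x⟫))) :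
    IsWeaklyDivFree u₀ := by
  intro θ hθ
  have h := htrace _ (Seregin2014Limit.isTestFunctionOn_gradient hθ)
  have h0 : ∀ t : ℝ, t < 0 → ∫ x, ⟪W t x, gradient θ x⟫ = 0 := fun t ht => hW.isWeaklyDivFree ht θ hθ
  have hev : (fun t => ∫ x, ⟪W t x, gradient θ x⟫) =ᶠ[𝓝[<] (0 : ℝ)] fun _ => (0 : ℝ) := by
    filter_upwards [self_mem_nhdsWithin] with t ht
    exact h0 t ht
  have h2 : Tendsto (fun t => ∫ x, ⟪W t x, gradient θ x⟫) (𝓝[<] 0) (𝓝 0) :=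
    (tendsto_congr' hev).2 tendsto_const_nhds
  exact tendsto_nhds_unique h h2

/-! ### Packaged for the critical element -/

/-- `‖∇f(x)‖ = ‖D¹f(x)‖` (the first iterated derivative). -/
theorem norm_fderiv_eq_norm_iteratedFDeriv_one (f : EuclideanSpace ℝ (Fin 3) → EuclideanSpace ℝ (Fin 3))
    (x : EuclideanSpace ℝ (Fin 3)) : ‖fderiv ℝ f x‖ = ‖iteratedFDeriv ℝ 1 f x‖ := by
  rw [← norm_iteratedFDeriv_fderiv, norm_iteratedFDeriv_zero]

/-- **THE FINAL DATUM OF THE CRITICAL ELEMENT: weakly divergence-free across the apex, with an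
integrable vorticity attained in `L¹(ℝ³)` — no vorticity concentration.** For `K_c` minimal and
`w ∈ 𝒟_{C,K_c}` singular there are `A, L ≥ 0`, the `C¹` final datum `u₀` off the apex and its
gradient `Du₀` such that: `‖u₀‖ ≤ A/‖x‖`, `HasFDerivAt u₀ (Du₀ x) x` and `‖Du₀‖ ≤ L/‖x‖²` off the
apex; the trace of `w` is `u₀` for EVERY test field; `u₀` is weakly divergence-free on `ℝ³`;
`∫‖∇w(t) − Du₀‖ ≤ 9|B₁| L √(−t)` and `∫‖curl w(t) − curlCLM ∘ Du₀‖ ≤ 36|B₁| L √(−t)`;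
`∫_{B(0,ρ)} ‖curlCLM (Du₀ x)‖ ≤ 12|B₁| L ρ`; and `∫⟪w(t), curl ψ⟫ → ∫⟪curlCLM ∘ Du₀, ψ⟫` for
every test field. [cite: KochNadirashviliSereginSverak2009, §4 (arXiv:0709.3599 p. 8)] -/
theorem finalDatum_vorticity_of_minimal {C Kc : ℝ}
    (hmin : ∀ K' : ℝ, K' < Kc → ∀ v : ℝ → EuclideanSpace ℝ (Fin 3) → EuclideanSpace ℝ (Fin 3),
      IsTypeIAncientMild C v →
      (∀ s : ℝ, s < 0 → ∫⁻ x, ‖fderiv ℝ (v s) x‖ₑ ^ 2 ≤ ENNReal.ofReal (K' / Real.sqrt (-s))) →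
      ¬ (∀ r > 0, ∀ M : ℝ, ∃ t ∈ Set.Ioo (-(r ^ 2)) (0 : ℝ),
        ∃ x ∈ Metric.ball (0 : EuclideanSpace ℝ (Fin 3)) r, M < ‖v t x‖))
    {w : ℝ → EuclideanSpace ℝ (Fin 3) → EuclideanSpace ℝ (Fin 3)} (hw : IsTypeIAncientMild C w)
    (hDw : ∀ s : ℝ, s < 0 → ∫⁻ x, ‖fderiv ℝ (w s) x‖ₑ ^ 2 ≤ ENNReal.ofReal (Kc / Real.sqrt (-s)))
    (hsw : ∀ r > 0, ∀ M : ℝ, ∃ t ∈ Set.Ioo (-(r ^ 2)) (0 : ℝ),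
      ∃ x ∈ Metric.ball (0 : EuclideanSpace ℝ (Fin 3)) r, M < ‖w t x‖) :
    ∃ (A L : ℝ) (u₀ : EuclideanSpace ℝ (Fin 3) → EuclideanSpace ℝ (Fin 3))
      (Du₀ : EuclideanSpace ℝ (Fin 3) → ((EuclideanSpace ℝ (Fin 3)) →L[ℝ] (EuclideanSpace ℝ (Fin 3)))),
      0 ≤ A ∧ 0 ≤ L ∧
      (∀ x : EuclideanSpace ℝ (Fin 3), x ≠ 0 → ‖u₀ x‖ ≤ A / ‖x‖) ∧
      (∀ x : EuclideanSpace ℝ (Fin 3), x ≠ 0 → HasFDerivAt u₀ (Du₀ x) x) ∧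
      (∀ x : EuclideanSpace ℝ (Fin 3), x ≠ 0 → ‖Du₀ x‖ ≤ L / ‖x‖ ^ 2) ∧
      (∀ ψ : EuclideanSpace ℝ (Fin 3) → EuclideanSpace ℝ (Fin 3),
        FunctionSpaces.IsTestFunctionOn (⊤ : Opens (EuclideanSpace ℝ (Fin 3))) ψ →
        Tendsto (fun t => ∫ x, ⟪w t x, ψ x⟫) (𝓝[<] 0) (𝓝 (∫ x, ⟪u₀ x, ψ x⟫))) ∧
      IsWeaklyDivFree u₀ ∧
      (∀ t : ℝ, t < 0 → ∫⁻ x, ‖fderiv ℝ (w t) x - Du₀ x‖ₑ ≤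
        ENNReal.ofReal (3 * (3 * (volume : Measure (EuclideanSpace ℝ (Fin 3))).real (ball 0 1)) *
          L * Real.sqrt (-t))) ∧
      (∀ t : ℝ, t < 0 → ∫⁻ x, ‖curl (w t) x - curlCLM (Du₀ x)‖ₑ ≤
        ENNReal.ofReal (4 * (3 * (3 * (volume : Measure (EuclideanSpace ℝ (Fin 3))).real (ball 0 1)) *
          L * Real.sqrt (-t)))) ∧
      (∀ ρ > 0, ∫⁻ x in ball (0 : EuclideanSpace ℝ (Fin 3)) ρ, ‖curlCLM (Du₀ x)‖ₑ ≤
        ENNReal.ofReal (4 * (3 * (volume : Measure (EuclideanSpace ℝ (Fin 3))).real (ball 0 1)) *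
          L * ρ)) ∧
      (∀ ψ : EuclideanSpace ℝ (Fin 3) → EuclideanSpace ℝ (Fin 3),
        FunctionSpaces.IsTestFunctionOn (⊤ : Opens (EuclideanSpace ℝ (Fin 3))) ψ →
        Tendsto (fun t => ∫ x, ⟪w t x, curl ψ x⟫) (𝓝[<] 0)
          (𝓝 (∫ x, ⟪curlCLM (Du₀ x), ψ x⟫))) := by
  -- the final-datum profile of lead g7 and its remainder energy (lead g9)
  obtain ⟨A, L₀, L₁, u₀, Du₀, hA0, -, hL₁, -, hrate, henv, hgrate, hgenv, hderiv, -, -⟩ :=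
    FinalDatum.finalDatum_profile_of_minimal hmin hw hDw hsw
  have hu₀m := EnergyRemainder.aestronglyMeasurable_finalDatum hw hrate
  have hener := EnergyRemainder.lintegral_sub_finalDatum_sq_le hw henv hrate
  have htrace : ∀ ψ : EuclideanSpace ℝ (Fin 3) → EuclideanSpace ℝ (Fin 3),
      FunctionSpaces.IsTestFunctionOn (⊤ : Opens (EuclideanSpace ℝ (Fin 3))) ψ →
      Tendsto (fun t => ∫ x, ⟪w t x, ψ x⟫) (𝓝[<] 0) (𝓝 (∫ x, ⟪u₀ x, ψ x⟫)) :=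
    fun ψ hψ => EnergyTrace.tendsto_pairing_of_energy hw hu₀m hener hψ
  -- the gradient envelope of the scale-invariant package (`n = 1`)
  obtain ⟨Q, -, hS⟩ := Envelope.scaleInvariantBounds_of_minimal hmin hw hDw hsw
  obtain ⟨Lg, hLg⟩ := hS 1
  set L : ℝ := max L₁ Lg with hL
  have hLnn : 0 ≤ L := hL₁.trans (le_max_left _ _)
  have hgradW : ∀ t : ℝ, t < 0 → ∀ x, ‖fderiv ℝ (w t) x‖ ≤ L / (‖x‖ + Real.sqrt (-t)) ^ 2 := by
    intro t ht x
    have h := (hLg t ht x).1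
    rw [← norm_fderiv_eq_norm_iteratedFDeriv_one, show (1 + 1 : ℕ) = 2 by norm_num] at h
    have hden : 0 < (‖x‖ + Real.sqrt (-t)) ^ 2 :=
      pow_pos (add_pos_of_nonneg_of_pos (norm_nonneg _) (Real.sqrt_pos.2 (neg_pos.2 ht))) 2
    exact h.trans (div_le_div_of_nonneg_right (le_max_right _ _) hden.le)
  have hgenv' : ∀ x : EuclideanSpace ℝ (Fin 3), x ≠ 0 → ‖Du₀ x‖ ≤ L / ‖x‖ ^ 2 := fun x hx =>
    (hgenv x hx).trans (div_le_div_of_nonneg_right (le_max_left _ _) (by positivity))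
  have hgrate' : ∀ x : EuclideanSpace ℝ (Fin 3), x ≠ 0 → ∀ t : ℝ, t < 0 →
      ‖fderiv ℝ (w t) x - Du₀ x‖ ≤ L * (-t) / ‖x‖ ^ 4 := by
    intro x hx t ht
    refine (hgrate x hx t ht).trans (div_le_div_of_nonneg_right ?_ (by positivity))
    exact mul_le_mul_of_nonneg_right (le_max_left _ _) (neg_nonneg.2 ht.le)
  exact ⟨A, L, u₀, Du₀, hA0, hLnn, henv, hderiv, hgenv', htrace, isWeaklyDivFree_finalDatum hw htrace,
    fun t ht => lintegral_fderiv_sub_finalDatum_le hgradW hgenv' hgrate' ht,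
    fun t ht => lintegral_curl_sub_finalDatum_le hgradW hgenv' hgrate' ht,
    fun ρ hρ => lintegral_ball_curlDatum_le hgenv' hρ,
    fun ψ hψ => tendsto_pairing_curl_finalDatum hw hgradW hgenv' hgrate' hψ⟩

end Summit.NavierStokesRegularity.NavierStokesRegularity.Theorems.FiniteDissipationLiouville.FinalDatumVorticity

end
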